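import Literature.AlgebraicGeometry.Resolution.WeightedResolutionDatum
import Literature.AlgebraicGeometry.Resolution.CobordantBlowupGlobal
import HarnessLib

/-!
# Cobordant blow-ups (Włodarczyk 2022): the THREE-ALGEBRA BRIDGE
# `extReesAlgebra 𝒥 = ⊕ₙ 𝒥ₙ tⁿ (coefficientwise) = A[t⁻¹, uᵢ t^{wᵢ}]`, with its element / ideal / local-ring dictionary

Topic: `Literature/AlgebraicGeometry/Resolution`. The tree carries THREE renderings of Włodarczyk's extended Rees algebra
of a weighted centre (arXiv:2203.03090, Def. 2.3.5: "`B := Spec_X(𝒪_X[t⁻¹, t^{w₁} x₁, …, t^{w_k} x_k])`"; App. Def. 5.1.1: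
"the full cobordant blow-up of `R` is `B := Spec_X(R[t⁻¹])`"):

* `extReesAlgebra I` (`WeightedResolutionDatum.lean`) — the `A`-subalgebra of `A[t, t⁻¹]` GENERATED by `t⁻¹` and the
  `a tⁿ`, `n ≥ 1`, `a ∈ Iₙ`; this is the carrier of the local weighted game of the door crux `HypersurfaceCentreConstruction`
  (`cobordantAlgebra' u w := extReesAlgebra (weightedMonomialIdeal u w)`, summit side);
* `IdealFiltration.extendedRees F` (`CobordantBlowupFiltration.lean`) — the Laurent polynomials whose `tⁿ`-coefficient lies in
  `𝒥ₙ` for `n ≥ 0` (COEFFICIENTWISE); this is the sections ring `ReesFiltration.sectionsRing` of the global cobordant blow-up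
  `Spec_Y ⊕ 𝒥ₙ tⁿ` (`CobordantBlowupGlobal.lean`) and the algebra that LOCALIZES (`CobordantBlowupFiltrationLocalization.lean`);
* `cobordantAlgebra u w` (`CobordantBlowupAlgebra.lean`) — `A[t⁻¹, uᵢ t^{wᵢ}]`, generated by `t⁻¹` and the `uᵢ t^{wᵢ}`; this is
  the algebra whose regularity / charts / exceptional divisor are proved (`CobordantBlowup*.lean`).

This file identifies them and transports the named elements and ideals, so that a statement typed on one carrier can be
read on another:

* `weightedMonomialIdeal_eq_weightedFiltration_ideal` — `(u^α : Σ wᵢ αᵢ ≥ n)` with exponents `Fin m → ℕ` is the library's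
  `𝒥ₙ(u, w)` with exponents `Fin m →₀ ℕ`;
* `IdealFiltration.extReesAlgebra_ideal_eq_extendedRees` — **`extReesAlgebra F.ideal = F.extendedRees`** for every descending
  multiplicative filtration; corollaries `extReesAlgebra_weightedMonomialIdeal_eq_extendedRees`,
  `extReesAlgebra_weightedMonomialIdeal_eq_cobordantAlgebra` (**`extReesAlgebra (weightedMonomialIdeal u w) = cobordantAlgebra u w`**);
* along the identifications `Subalgebra.equivOfEq` (the identity on Laurent polynomials): `t⁻¹ ↦ t⁻¹ ↦ s`
  (`equivOfEq_tInv`, `equivOfEq_tInv_eq_s`), the structure maps commute, the vertex ideal `(a tⁿ : n ≥ 1)` goes to the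
  irrelevant ideal `⊕_{n>0} 𝒥ₙ tⁿ` (`map_vertexIdeal_eq_irrelevant`) and, for a weighted centre, to the ideal of the
  positively weighted `uᵢ t^{wᵢ}` (`map_vertexIdeal_eq_span_u'`; `= cobordantAlgebra.vertexIdeal` when all weights are
  positive), the `t⁻¹`-saturated strict transform goes to the `t⁻¹`-saturation / `cobordantAlgebra.strictTransform`
  (`map_strictTransform_eq_saturation`, `map_strictTransform_eq_cobordantStrictTransform`);
* local rings at corresponding primes and the CHART → STALK → GAME-SIDE bridge at a prime are in the sequel
  `CobordantBlowupExtReesLocalization.lean`.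

Summit-side near-duplicates (for the librarians' retire list; Literature cannot import them): `WeightedThesis.DatumCobordantBridge.
{weightedMonomialIdeal_eq_weightedFiltration_ideal, extReesAlgebra_eq_extendedRees}` (Theorems/WeightedInvariantWeightedThesisDatumCobordantBridge)
and `DatumToEmbedded.InvDrop.{ringEquiv_T, map_irrelevant, map_saturation}`. All proofs are glue on Mathlib and the tree;
no definition is declared.

## Sources

* J. Włodarczyk, *Functorial resolution by torus actions*, arXiv:2203.03090: Lemma 2.1.8 / 2.1.9 (`𝒜_𝒥 = ⊕ I_{ν,a} t^a`),
  §2.2 (vertex `V(Σ_{a>0} R_a)`), Def. 2.3.5 (`B = Spec 𝒪_X[t⁻¹, t^{wᵢ} xᵢ]`, `B₊ = B ∖ Vert`), §3.3 / 3.3.12 (strict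
  transform = `t⁻¹`-saturation), App. Def. 5.1.1 (`B = Spec_X R[t⁻¹]`). [Wlodarczyk2022]
-/

noncomputable section

open scoped LaurentPolynomial
open LaurentPolynomial

namespace Literature.AlgebraicGeometry.Resolution

universe u v

/-! ## §1 The two renderings of the weighted monomial ideals agree -/

section Monomial

variable {A : Type u} [CommRing A] {m : ℕ} (u : Fin m → A) (w : Fin m → ℕ)

/-- The generating monomials agree: exponent vectors `Fin m → ℕ` versus finitely supported functions `Fin m →₀ ℕ`.
[folklore] -/
private theorem setOf_weightedMonomial_eq_weightedMonomials (n : ℕ) :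
    {x : A | ∃ α : Fin m → ℕ, n ≤ ∑ i, w i * α i ∧ x = ∏ i, u i ^ α i} = weightedMonomials u w n := by
  ext x
  constructor
  · rintro ⟨α, hα, rfl⟩
    refine ⟨Finsupp.equivFunOnFinite.symm α, ?_, ?_⟩
    · rw [Finsupp.weight_apply, Finsupp.sum_fintype _ _ (fun i => by simp)]
      simpa [Finsupp.coe_equivFunOnFinite_symm, smul_eq_mul, mul_comm] using hα
    · rw [Finsupp.prod_fintype _ _ (fun i => by simp)]
      simp
  · rintro ⟨α, hα, rfl⟩
    refine ⟨⇑α, ?_, ?_⟩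
    · rw [Finsupp.weight_apply, Finsupp.sum_fintype _ _ (fun i => by simp)] at hα
      simpa [smul_eq_mul, mul_comm] using hα
    · rw [Finsupp.prod_fintype _ _ (fun i => by simp)]

/-- **The weighted monomial ideal of `WeightedResolutionDatum` is the library's `𝒥ₙ(u, w)`**:
`weightedMonomialIdeal u w n = (weightedFiltration u w).ideal n` (Włodarczyk, Lemma 2.1.9: `(𝒥^a)_X = (u^α | Σ αᵢ wᵢ ≥ a)`).
[cite: Wlodarczyk2022, Lemma 2.1.9] -/
theorem weightedMonomialIdeal_eq_weightedFiltration_ideal (n : ℕ) :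
    weightedMonomialIdeal u w n = (weightedFiltration u w).ideal n := by
  rw [weightedMonomialIdeal, weightedFiltration_ideal, setOf_weightedMonomial_eq_weightedMonomials]

/-- The same, as an equality of sequences of ideals `ℕ → Ideal A`. [cite: Wlodarczyk2022, Lemma 2.1.9] -/
theorem weightedMonomialIdeal_eq_weightedFiltration_ideal' :
    weightedMonomialIdeal u w = (weightedFiltration u w).ideal :=
  funext (weightedMonomialIdeal_eq_weightedFiltration_ideal u w)

end Monomial

/-! ## §2 The generated and the coefficientwise extended Rees algebras agree -/

section Rees

variable {A : Type u} [CommRing A]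

/-- `a t⁻ᵏ ∈ A[t⁻¹, Jₙ tⁿ]` for every `a ∈ A`. [folklore] -/
private theorem extReesAlgebra.C_mul_T_neg_natCast_mem (I : ℕ → Ideal A) (a : A) (k : ℕ) :
    C a * T (-(k : ℤ)) ∈ extReesAlgebra I := by
  refine Subalgebra.mul_mem _ ?_ ?_
  · rw [C_eq_algebraMap]
    exact Subalgebra.algebraMap_mem _ a
  · have hT : (T (-(k : ℤ)) : A[T;T⁻¹]) = T (-1) ^ k := by
      rw [T_pow]; congr 1; ring
    rw [hT]
    exact Subalgebra.pow_mem _ (Algebra.subset_adjoin (Set.mem_insert _ _)) k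

/-- **`extReesAlgebra F.ideal = F.extendedRees`**: for a descending multiplicative filtration `F`, the subalgebra of
`A[t, t⁻¹]` generated by `t⁻¹` and the `a tⁿ` (`n ≥ 1`, `a ∈ 𝒥ₙ`) is the subalgebra of Laurent polynomials whose
`tⁿ`-coefficient lies in `𝒥ₙ` for every `n ≥ 0` (Włodarczyk, App. Def. 5.1.1: `R[t⁻¹] = 𝒪_X[t⁻¹] ⊕ ⊕_{a>0} R_a t^a`).
`≤`: the generators satisfy the coefficient conditions; `≥`: decompose along the finite support — negative degrees are
`a (t⁻¹)ᵏ`, degree `0` is a constant, positive degrees are generators. [cite: Wlodarczyk2022, Def. 5.1.1] -/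
theorem IdealFiltration.extReesAlgebra_ideal_eq_extendedRees (F : IdealFiltration A) :
    extReesAlgebra F.ideal = F.extendedRees := by
  apply le_antisymm
  · refine Algebra.adjoin_le ?_
    rintro x (rfl | ⟨n, _, a, ha, rfl⟩)
    · exact F.T_neg_one_mem_extendedRees
    · exact F.C_mul_T_mem_extendedRees_iff.mpr ha
  · intro p hp
    rw [← AddMonoidAlgebra.sum_coeff_single p, Finsupp.sum]
    refine Subalgebra.sum_mem _ fun n _ => ?_
    rw [single_eq_C_mul_T]
    rcases lt_or_ge n 0 with hn | hn
    · obtain ⟨k, hk⟩ := Int.exists_eq_neg_ofNat hn.le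
      rw [hk]
      exact extReesAlgebra.C_mul_T_neg_natCast_mem F.ideal _ k
    · obtain ⟨j, rfl⟩ := Int.eq_ofNat_of_zero_le hn
      have hj : p.coeff (j : ℤ) ∈ F.ideal j := (F.mem_extendedRees_iff.mp hp) j
      rcases Nat.eq_zero_or_pos j with rfl | hjpos
      · rw [Nat.cast_zero, T_zero, mul_one, C_eq_algebraMap]
        exact Subalgebra.algebraMap_mem _ _
      · exact extReesAlgebra.C_mul_T_mem F.ideal hjpos hj

variable {m : ℕ} (u : Fin m → A) (w : Fin m → ℕ)

/-- **`extReesAlgebra (weightedMonomialIdeal u w) = ⊕ₙ 𝒥ₙ(u, w) tⁿ`** (coefficientwise). [cite: Wlodarczyk2022, Lemma 2.1.8] -/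
theorem extReesAlgebra_weightedMonomialIdeal_eq_extendedRees :
    extReesAlgebra (weightedMonomialIdeal u w) = (weightedFiltration u w).extendedRees := by
  rw [weightedMonomialIdeal_eq_weightedFiltration_ideal', IdealFiltration.extReesAlgebra_ideal_eq_extendedRees]

/-- **`extReesAlgebra (weightedMonomialIdeal u w) = cobordantAlgebra u w = A[t⁻¹, uᵢ t^{wᵢ}]`**: the game-side carrier of the
door crux is Włodarczyk's algebra of the full cobordant blow-up (through `cobordantAlgebra_eq_extendedRees`).
[cite: Wlodarczyk2022, Def. 2.3.5] -/
theorem extReesAlgebra_weightedMonomialIdeal_eq_cobordantAlgebra :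
    extReesAlgebra (weightedMonomialIdeal u w) = cobordantAlgebra u w := by
  rw [extReesAlgebra_weightedMonomialIdeal_eq_extendedRees, cobordantAlgebra_eq_extendedRees]

end Rees

/-! ## §3 Transport along the identifications (any ring isomorphism that is the identity on Laurent polynomials)

Bookkeeping of the identification `𝒪_B = 𝒪_X[t⁻¹, t^{wᵢ} xᵢ] = R[t⁻¹]` of Włodarczyk's Def. 2.3.5 with App. Def. 5.1.1: the two
subalgebras of `𝒪_X[t, t⁻¹]` are compared by an `𝒪_X`-algebra isomorphism that is the identity on Laurent polynomials, and
every named element / ideal is read off the underlying Laurent polynomials. -/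

section Transport

variable {A : Type u} [CommRing A] {B₁ B₂ : Subalgebra A A[T;T⁻¹]}
  (e : B₁ ≃+* B₂) (he : ∀ x : B₁, ((e x : B₂) : A[T;T⁻¹]) = x)

/-- Two subalgebras of `A[t, t⁻¹]` that are EQUAL are isomorphic by a ring isomorphism that is the identity on Laurent
polynomials (`Subalgebra.equivOfEq`). [folklore] -/
private theorem exists_ringEquiv_coe_eq (h : B₁ = B₂) : ∃ e : B₁ ≃+* B₂, ∀ x : B₁, ((e x : B₂) : A[T;T⁻¹]) = x :=
  ⟨(Subalgebra.equivOfEq B₁ B₂ h).toRingEquiv, fun _ => rfl⟩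

include he

/-- The inverse identification is the identity on Laurent polynomials too. [cite: Wlodarczyk2022, Def. 5.1.1] -/
theorem coe_symm_apply_eq (y : B₂) : ((e.symm y : B₁) : A[T;T⁻¹]) = y := by
  rw [← he (e.symm y), e.apply_symm_apply]

/-- Such an identification commutes with the structure maps `A → Bᵢ`. [cite: Wlodarczyk2022, Def. 5.1.1] -/
theorem apply_algebraMap_eq (a : A) : e (algebraMap A B₁ a) = algebraMap A B₂ a :=
  Subtype.ext ((he _).trans (by rw [Subalgebra.coe_algebraMap, Subalgebra.coe_algebraMap]))

/-- … as ring homomorphisms. [cite: Wlodarczyk2022, Def. 5.1.1] -/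
theorem toRingHom_comp_algebraMap_eq : (e : B₁ →+* B₂).comp (algebraMap A B₁) = algebraMap A B₂ :=
  RingHom.ext fun a => apply_algebraMap_eq e he a

/-- The extension of an ideal `𝔞 ≤ A` to `B₁` is carried onto its extension to `B₂`. [cite: Wlodarczyk2022, Def. 5.1.1] -/
theorem map_map_algebraMap_eq (𝔞 : Ideal A) :
    (𝔞.map (algebraMap A B₁)).map e = 𝔞.map (algebraMap A B₂) := by
  rw [← toRingHom_comp_algebraMap_eq e he, ← Ideal.map_map]
  rfl

/-- Membership in the extension of `𝔞` is preserved: `e x ∈ 𝔞 B₂ ↔ x ∈ 𝔞 B₁`. [cite: Wlodarczyk2022, Def. 5.1.1] -/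
theorem apply_mem_map_algebraMap_iff (𝔞 : Ideal A) (x : B₁) :
    e x ∈ 𝔞.map (algebraMap A B₂) ↔ x ∈ 𝔞.map (algebraMap A B₁) := by
  rw [← map_map_algebraMap_eq e he 𝔞, Ideal.apply_mem_of_equiv_iff]

/-- The image of a set of elements described by their underlying Laurent polynomials. [cite: Wlodarczyk2022, Def. 5.1.1] -/
theorem image_setOf_coe_eq (Q : A[T;T⁻¹] → Prop) :
    e '' {x : B₁ | Q (x : A[T;T⁻¹])} = {y : B₂ | Q (y : A[T;T⁻¹])} := by
  ext y
  constructor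
  · rintro ⟨x, hx, rfl⟩
    exact (show Q ((e x : B₂) : A[T;T⁻¹]) by rw [he]; exact hx)
  · intro hy
    exact ⟨e.symm y, show Q ((e.symm y : B₁) : A[T;T⁻¹]) by rw [coe_symm_apply_eq e he]; exact hy,
      e.apply_symm_apply y⟩

/-- The span of such a set is carried onto the span of the corresponding set. [cite: Wlodarczyk2022, Def. 5.1.1] -/
theorem map_span_setOf_coe_eq (Q : A[T;T⁻¹] → Prop) :
    (Ideal.span {x : B₁ | Q (x : A[T;T⁻¹])}).map e = Ideal.span {y : B₂ | Q (y : A[T;T⁻¹])} := by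
  rw [Ideal.map_span]
  exact congrArg Ideal.span (image_setOf_coe_eq e he Q)

/-- `t⁻¹`-saturations correspond: for elements `s₁ ↦ s₂` (playing `t⁻¹`), `(s₂)ⁿ y ∈ 𝔞 B₂` for some `n` iff
`(s₁)ⁿ e⁻¹(y) ∈ 𝔞 B₁` for some `n`. [cite: Wlodarczyk2022, Def. 5.1.1] -/
theorem exists_pow_mul_mem_map_iff {s₁ : B₁} {s₂ : B₂} (hs : e s₁ = s₂) (𝔞 : Ideal A) (y : B₂) :
    (∃ n : ℕ, s₂ ^ n * y ∈ 𝔞.map (algebraMap A B₂)) ↔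
      ∃ n : ℕ, s₁ ^ n * e.symm y ∈ 𝔞.map (algebraMap A B₁) := by
  refine exists_congr fun n => ?_
  rw [show s₂ ^ n * y = e (s₁ ^ n * e.symm y) by rw [map_mul, map_pow, hs, e.apply_symm_apply],
    apply_mem_map_algebraMap_iff e he]

end Transport

/-! ## §3a The game-side carrier versus the coefficientwise extended Rees algebra -/

section TransportFiltration

variable {A : Type u} [CommRing A] (F : IdealFiltration A) {I : ℕ → Ideal A}
  (e : extReesAlgebra I ≃+* F.extendedRees) (he : ∀ x, ((e x : F.extendedRees) : A[T;T⁻¹]) = x)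

/-- **Existence of the identification** `extReesAlgebra I ≃+* ⊕ₙ 𝒥ₙ tⁿ` (identity on Laurent polynomials) whenever `𝒥ₙ = Iₙ`.
[cite: Wlodarczyk2022, Def. 5.1.1] -/
theorem IdealFiltration.exists_ringEquiv_extReesAlgebra (hI : F.ideal = I) :
    ∃ e : extReesAlgebra I ≃+* F.extendedRees, ∀ x, ((e x : F.extendedRees) : A[T;T⁻¹]) = x :=
  exists_ringEquiv_coe_eq (hI ▸ F.extReesAlgebra_ideal_eq_extendedRees)

include he

/-- `t⁻¹ ↦ t⁻¹`. [cite: Wlodarczyk2022, Rem. 2.3.10] -/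
theorem IdealFiltration.ringEquiv_tInv :
    e (extReesAlgebra.tInv I) = ⟨T (-1), F.T_neg_one_mem_extendedRees⟩ :=
  Subtype.ext (he _)

/-- A prime of `⊕ 𝒥ₙ tⁿ` contains `t⁻¹` iff its preimage contains `t⁻¹` (the exceptional fibres correspond). [cite: Wlodarczyk2022, Lemma 2.3.8] -/
theorem IdealFiltration.T_mem_iff_tInv_mem_comap (𝔫 : Ideal F.extendedRees) :
    (⟨T (-1), F.T_neg_one_mem_extendedRees⟩ : F.extendedRees) ∈ 𝔫 ↔ extReesAlgebra.tInv I ∈ 𝔫.comap e := by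
  rw [Ideal.mem_comap, F.ringEquiv_tInv e he]

/-- **The vertex ideal `(a tⁿ : n ≥ 1, a ∈ Iₙ)` is carried onto the irrelevant ideal `⊕_{n>0} 𝒥ₙ tⁿ`** (same generators;
Włodarczyk §2.2: the vertex is `V(Σ_{a>0} R_a)`). [cite: Wlodarczyk2022, §2.2] -/
theorem IdealFiltration.map_vertexIdeal_eq_irrelevant (hI : F.ideal = I) :
    (extReesAlgebra.vertexIdeal I).map e = F.irrelevant := by
  subst hI
  rw [extReesAlgebra.vertexIdeal, IdealFiltration.irrelevant, Ideal.map_span]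
  congr 1
  ext y
  constructor
  · rintro ⟨x, ⟨n, hn, a, ha, hx⟩, rfl⟩
    exact ⟨n, a, hn, ha, (he x).trans hx⟩
  · rintro ⟨n, a, hn, ha, hy⟩
    exact ⟨e.symm y, ⟨n, hn, a, ha, (coe_symm_apply_eq e he y).trans hy⟩, e.apply_symm_apply y⟩

/-- Hence: a prime of `⊕ 𝒥ₙ tⁿ` contains the irrelevant ideal iff its preimage contains the vertex ideal (the vertex
points correspond, and so do their complements `B₊`). [cite: Wlodarczyk2022, Def. 5.1.1] -/
theorem IdealFiltration.irrelevant_le_iff_vertexIdeal_le_comap (hI : F.ideal = I) (𝔫 : Ideal F.extendedRees) :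
    F.irrelevant ≤ 𝔫 ↔ extReesAlgebra.vertexIdeal I ≤ 𝔫.comap e := by
  rw [← F.map_vertexIdeal_eq_irrelevant e he hI, Ideal.map_le_iff_le_comap]

/-- **The strict transform `σˢ(𝔞)` (the `t⁻¹`-saturation of `𝔞 · extReesAlgebra I`, `extReesAlgebra.strictTransform`) is
carried onto the `t⁻¹`-saturation of `𝔞 · ⊕ 𝒥ₙ tⁿ`** — membership form (Włodarczyk 3.3.12). [cite: Wlodarczyk2022, 3.3.12] -/
theorem IdealFiltration.mem_map_strictTransform_iff (𝔞 : Ideal A) (y : F.extendedRees) :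
    y ∈ (extReesAlgebra.strictTransform I 𝔞).map e ↔
      ∃ n : ℕ, (⟨T (-1), F.T_neg_one_mem_extendedRees⟩ : F.extendedRees) ^ n * y ∈
        𝔞.map (algebraMap A F.extendedRees) := by
  rw [← Ideal.symm_apply_mem_of_equiv_iff, extReesAlgebra.mem_strictTransform_iff,
    exists_pow_mul_mem_map_iff e he (F.ringEquiv_tInv e he) 𝔞 y]

/-- The same, as an equality with the saturation `⋃ₙ (𝔞 · ⊕ 𝒥ₙ tⁿ : (t⁻¹)ⁿ)` written with colon ideals.
[cite: Wlodarczyk2022, 3.3.12] -/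
theorem IdealFiltration.map_strictTransform_eq_saturation (𝔞 : Ideal A) :
    (extReesAlgebra.strictTransform I 𝔞).map e =
      ⨆ n : ℕ, (𝔞.map (algebraMap A F.extendedRees)).colon
        {(⟨T (-1), F.T_neg_one_mem_extendedRees⟩ : F.extendedRees) ^ n} := by
  have hmono : Monotone fun n : ℕ => (𝔞.map (algebraMap A F.extendedRees)).colon
      {(⟨T (-1), F.T_neg_one_mem_extendedRees⟩ : F.extendedRees) ^ n} := by
    refine monotone_nat_of_le_succ fun n f hf => ?_
    rw [Submodule.mem_colon_singleton, smul_eq_mul] at hf ⊢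
    rw [pow_succ, ← mul_assoc]
    exact Ideal.mul_mem_right _ _ hf
  ext y
  rw [F.mem_map_strictTransform_iff e he, Submodule.mem_iSup_of_directed _ hmono.directed_le]
  simp only [Submodule.mem_colon_singleton, smul_eq_mul, mul_comm y]

end TransportFiltration

/-! ## §3b The game-side carrier versus Włodarczyk's `A[t⁻¹, uᵢ t^{wᵢ}]` -/

section TransportCobordant

variable {A : Type u} [CommRing A] {m : ℕ} (u : Fin m → A) (w : Fin m → ℕ)
  (e : extReesAlgebra (weightedMonomialIdeal u w) ≃+* cobordantAlgebra u w)
  (he : ∀ x, ((e x : cobordantAlgebra u w) : A[T;T⁻¹]) = x)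

/-- **Existence of the identification** `extReesAlgebra (weightedMonomialIdeal u w) ≃+* cobordantAlgebra u w` (identity on
Laurent polynomials). [cite: Wlodarczyk2022, Def. 2.3.5] -/
theorem exists_ringEquiv_extReesAlgebra_cobordantAlgebra :
    ∃ e : extReesAlgebra (weightedMonomialIdeal u w) ≃+* cobordantAlgebra u w,
      ∀ x, ((e x : cobordantAlgebra u w) : A[T;T⁻¹]) = x :=
  exists_ringEquiv_coe_eq (extReesAlgebra_weightedMonomialIdeal_eq_cobordantAlgebra u w)

/-- `uᵢ ∈ (u^α : Σ wⱼ αⱼ ≥ wᵢ)` (exponent `α = eᵢ`). [cite: Wlodarczyk2022, Lemma 2.1.9] -/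
theorem mem_weightedMonomialIdeal_self (i : Fin m) : u i ∈ weightedMonomialIdeal u w (w i) := by
  rw [weightedMonomialIdeal_eq_weightedFiltration_ideal]
  exact mem_weightedFiltration_ideal u w i

/-- `a tⁿ ∈ A[t⁻¹, uᵢ t^{wᵢ}]` for `a ∈ (u^α : Σ wᵢ αᵢ ≥ n)`. [cite: Wlodarczyk2022, Lemma 2.1.8] -/
theorem C_mul_T_mem_cobordantAlgebra_of_mem {n : ℕ} {a : A} (ha : a ∈ weightedMonomialIdeal u w n) :
    C a * T (n : ℤ) ∈ cobordantAlgebra u w := by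
  rw [cobordantAlgebra_eq_extendedRees, IdealFiltration.C_mul_T_mem_extendedRees_iff,
    ← weightedMonomialIdeal_eq_weightedFiltration_ideal]
  exact ha

/-- KEY COMPUTATION: for `n ≥ 1` and `a ∈ (u^α : Σ wᵢ αᵢ ≥ n)`, the element `a tⁿ` of `A[t⁻¹, uᵢ t^{wᵢ}]` lies in the ideal
generated by the POSITIVELY weighted `uᵢ t^{wᵢ}` (a monomial `u^α tⁿ` of weight `≥ n ≥ 1` has a factor `uᵢ t^{wᵢ}` with
`wᵢ αᵢ ≥ 1`, the cofactor `u^{α - eᵢ} t^{n - wᵢ}` lying in the algebra). [cite: Wlodarczyk2022, Def. 2.3.5] -/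
theorem mem_span_u'_of_coe_eq {n : ℕ} (hn : 0 < n) {a : A} (ha : a ∈ weightedMonomialIdeal u w n)
    (y : cobordantAlgebra u w) (hy : (y : A[T;T⁻¹]) = C a * T (n : ℤ)) :
    y ∈ Ideal.span (cobordantAlgebra.u' u w '' {i | 0 < w i}) := by
  classical
  set J : Ideal (cobordantAlgebra u w) := Ideal.span (cobordantAlgebra.u' u w '' {i | 0 < w i}) with hJ
  revert y
  refine Submodule.span_induction (p := fun a _ => ∀ y : cobordantAlgebra u w,
      (y : A[T;T⁻¹]) = C a * T (n : ℤ) → y ∈ J) ?_ ?_ ?_ ?_ ha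
  · -- a monomial `u^α` of weight `≥ n`
    rintro _ ⟨α, hα, rfl⟩ y hy
    obtain ⟨i, -, hi⟩ : ∃ i ∈ (Finset.univ : Finset (Fin m)), w i * α i ≠ 0 :=
      Finset.exists_ne_zero_of_sum_ne_zero (by omega)
    obtain ⟨hwi, hαi⟩ : 0 < w i ∧ 0 < α i := by
      rcases Nat.eq_zero_or_pos (w i) with h | h
      · simp [h] at hi
      rcases Nat.eq_zero_or_pos (α i) with h' | h'
      · simp [h'] at hi
      exact ⟨h, h'⟩
    -- the cofactor `b = u^{α - eᵢ}` and its exponent `β`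
    set b : A := u i ^ (α i - 1) * ∏ j ∈ Finset.univ.erase i, u j ^ α j with hb
    have hprod : ∏ j, u j ^ α j = u i * b := by
      rw [hb, ← mul_assoc, ← pow_succ', Nat.sub_add_cancel hαi,
        Finset.mul_prod_erase _ (fun j => u j ^ α j) (Finset.mem_univ i)]
    set β : Fin m → ℕ := Function.update α i (α i - 1) with hβ
    have hprodβ : ∏ j, u j ^ β j = b := by
      rw [← Finset.mul_prod_erase _ (fun j => u j ^ β j) (Finset.mem_univ i), hb]
      congr 1
      · rw [hβ, Function.update_self]
      · refine Finset.prod_congr rfl fun j hj => ?_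
        rw [hβ, Function.update_of_ne (Finset.ne_of_mem_erase hj)]
    have hsumα : ∑ j, w j * α j = w i * α i + ∑ j ∈ Finset.univ.erase i, w j * α j :=
      (Finset.add_sum_erase _ (fun j => w j * α j) (Finset.mem_univ i)).symm
    have hsumβ : ∑ j, w j * β j = w i * (α i - 1) + ∑ j ∈ Finset.univ.erase i, w j * α j := by
      rw [← Finset.add_sum_erase _ (fun j => w j * β j) (Finset.mem_univ i)]
      congr 1
      · rw [hβ, Function.update_self]
      · refine Finset.sum_congr rfl fun j hj => ?_
        rw [hβ, Function.update_of_ne (Finset.ne_of_mem_erase hj)]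
    have hwt : ∑ j, w j * β j + w i = ∑ j, w j * α j := by
      rw [hsumα, hsumβ]
      have : w i * (α i - 1) + w i = w i * α i := by
        rw [← Nat.mul_succ, Nat.succ_eq_add_one, Nat.sub_add_cancel hαi]
      omega
    -- the cofactor `b t^{n - wᵢ}` lies in the algebra
    have hz : C b * T ((n : ℤ) - w i) ∈ cobordantAlgebra u w := by
      rw [cobordantAlgebra_eq_extendedRees, ← single_eq_C_mul_T, IdealFiltration.single_mem_extendedRees_iff]
      intro k hk
      rw [← weightedMonomialIdeal_eq_weightedFiltration_ideal]
      refine Ideal.subset_span ⟨β, ?_, hprodβ.symm⟩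
      omega
    -- `y = (uᵢ t^{wᵢ}) · (b t^{n - wᵢ})`
    have hyeq : y = cobordantAlgebra.u' u w i * ⟨_, hz⟩ := by
      apply Subtype.ext
      rw [hy, MulMemClass.coe_mul, cobordantAlgebra.coe_u', hprod, map_mul]
      calc C (u i) * C b * T (n : ℤ)
          = C (u i) * C b * (T (w i : ℤ) * T ((n : ℤ) - w i)) := by rw [← T_add]; congr 1; ring
        _ = C (u i) * T (w i : ℤ) * (C b * T ((n : ℤ) - w i)) := by ring
    rw [hyeq]
    exact Ideal.mul_mem_right _ _ (Ideal.subset_span ⟨i, hwi, rfl⟩)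
  · -- zero
    intro y hy
    rw [map_zero, zero_mul] at hy
    rw [show y = 0 from Subtype.ext hy]
    exact J.zero_mem
  · -- additivity
    intro a₁ a₂ ha₁ ha₂ ih₁ ih₂ y hy
    have h₁ := C_mul_T_mem_cobordantAlgebra_of_mem u w ha₁
    have h₂ := C_mul_T_mem_cobordantAlgebra_of_mem u w ha₂
    have hyeq : y = ⟨_, h₁⟩ + ⟨_, h₂⟩ := Subtype.ext (by rw [hy, AddMemClass.coe_add, map_add, add_mul])
    rw [hyeq]
    exact J.add_mem (ih₁ _ rfl) (ih₂ _ rfl)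
  · -- `A`-linearity
    intro c a ha ih y hy
    have h := C_mul_T_mem_cobordantAlgebra_of_mem u w ha
    have hyeq : y = algebraMap A (cobordantAlgebra u w) c * ⟨_, h⟩ := Subtype.ext (by
      rw [hy, MulMemClass.coe_mul, Subalgebra.coe_algebraMap, ← C_eq_algebraMap, smul_eq_mul, map_mul, mul_assoc])
    rw [hyeq]
    exact J.mul_mem_left _ (ih _ rfl)

include he

/-- `t⁻¹ ↦ s`. [cite: Wlodarczyk2022, Rem. 2.3.10] -/
theorem ringEquiv_tInv_eq_s : e (extReesAlgebra.tInv (weightedMonomialIdeal u w)) = cobordantAlgebra.s u w :=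
  Subtype.ext (he _)

/-- **The vertex ideal `(a tⁿ : n ≥ 1, a ∈ 𝒥ₙ)` of the game-side carrier is carried onto the ideal `(uᵢ t^{wᵢ} : wᵢ > 0)` of
`A[t⁻¹, uᵢ t^{wᵢ}]`** — the vertex `V(t^{w₁} u₁, …, t^{w_k} u_k)` of Def. 2.3.5 is cut out by the POSITIVELY weighted generators
(parameters of weight `0`, allowed on the game side, do not belong to the centre). [cite: Wlodarczyk2022, Def. 2.3.5] -/
theorem map_vertexIdeal_eq_span_u' :
    (extReesAlgebra.vertexIdeal (weightedMonomialIdeal u w)).map e =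
      Ideal.span (cobordantAlgebra.u' u w '' {i | 0 < w i}) := by
  apply le_antisymm
  · rw [extReesAlgebra.vertexIdeal, Ideal.map_span, Ideal.span_le]
    rintro _ ⟨x, ⟨n, hn, a, ha, hx⟩, rfl⟩
    exact mem_span_u'_of_coe_eq u w hn ha (e x) ((he x).trans hx)
  · rw [Ideal.span_le]
    rintro _ ⟨i, hi, rfl⟩
    have hx : C (u i) * T (w i : ℤ) ∈ extReesAlgebra (weightedMonomialIdeal u w) :=
      extReesAlgebra.C_mul_T_mem _ hi (mem_weightedMonomialIdeal_self u w i)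
    have hgen : (⟨_, hx⟩ : extReesAlgebra (weightedMonomialIdeal u w)) ∈
        extReesAlgebra.vertexIdeal (weightedMonomialIdeal u w) :=
      Ideal.subset_span ⟨w i, hi, u i, mem_weightedMonomialIdeal_self u w i, rfl⟩
    have heq : e ⟨_, hx⟩ = cobordantAlgebra.u' u w i := Subtype.ext (he _)
    rw [SetLike.mem_coe, ← heq]
    exact Ideal.mem_map_of_mem _ hgen

/-- When ALL weights are positive (a weighted chart, `ReesAlgebraData.IsWeightedChart.w_pos`), the vertex ideal is carried
onto `cobordantAlgebra.vertexIdeal u w = (u₁', …, uₘ')`. [cite: Wlodarczyk2022, Def. 2.3.5] -/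
theorem map_vertexIdeal_eq_cobordantVertexIdeal (hw : ∀ i, 0 < w i) :
    (extReesAlgebra.vertexIdeal (weightedMonomialIdeal u w)).map e = cobordantAlgebra.vertexIdeal u w := by
  rw [map_vertexIdeal_eq_span_u' u w e he, cobordantAlgebra.vertexIdeal]
  congr 1
  ext y
  simp only [Set.mem_image, Set.mem_setOf_eq, Set.mem_range]
  exact ⟨fun ⟨i, _, h⟩ => ⟨i, h⟩, fun ⟨i, h⟩ => ⟨i, hw i, h⟩⟩

/-- **The strict transform `σˢ(𝔞)` of the game-side carrier is carried onto `cobordantAlgebra.strictTransform u w 𝔞`** (both are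
the `t⁻¹`-saturation of `𝔞 · 𝒪_B`, Włodarczyk §3.3 / 3.3.12). [cite: Wlodarczyk2022, 3.3.12] -/
theorem map_strictTransform_eq_cobordantStrictTransform (𝔞 : Ideal A) :
    (extReesAlgebra.strictTransform (weightedMonomialIdeal u w) 𝔞).map e = cobordantAlgebra.strictTransform u w 𝔞 := by
  ext y
  rw [← Ideal.symm_apply_mem_of_equiv_iff, extReesAlgebra.mem_strictTransform_iff,
    cobordantAlgebra.mem_strictTransform_iff, exists_pow_mul_mem_map_iff e he (ringEquiv_tInv_eq_s u w e he) 𝔞 y]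

end TransportCobordant

end Literature.AlgebraicGeometry.Resolution

end
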